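import Summits.Ventures.HodgeRepro2.T5SU11JacobiPhaseLawRateScaled
import Summits.Ventures.HodgeRepro2.T5SU11JacobiJointLawExact

/-!
# The rate of the joint limit law, uniformly in `0 ≤ λ ≤ 2`: `|P_{k,λ}(joint) − e^{−max(x,y,z)}| ≤ (5M² + 3M + 2)/k`

`T5SU11JacobiJointLawAsymptotic` proves `P_{k,λ}(k log|a| > x, k|g·0|²/2 > y, k t²/2 > z) → e^{−max(x, y, z)}`.
This file makes it quantitative for `0 ≤ λ ≤ 2`. The joint event is the phase-threshold event
`{jointThreshold(x, y, z, k) < log|a|}`, and two estimates combine: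

* the general-threshold rate of `T5SU11JacobiPhaseLawRate`:
  `|P_{k,λ}(log|a| > τ) − e^{−(k−2)τ}| ≤ c(τ + 2/(k − 2)) e^{−(k−2)τ}`, `c = λ(2 − λ)/2 ≤ 1/2`;
* the elementary pinning of the rescaled threshold (`le_scaled_jointThreshold`, `scaled_jointThreshold_le`):
  `M − (2M + M²)/k ≤ (k − 2)·jointThreshold ≤ M + 4M²/k`, `M = max(x, y, z)`, for `k ≥ 4y`
  (from `u ≤ −log(1 − u) ≤ u/(1 − u)` and `(v²/2)/(1 + v²/2) ≤ log cosh v ≤ v²/2`),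

with `|e^{−A} − e^{−B}| ≤ |A − B|` on `[0, ∞)`. The result: for `k ≥ max(4, 4y)`, `x ≥ 0`, `y > 0`, `z ≥ 0`,

  **`|P_{k,λ}(k log|a| > x, k|g·0|²/2 > y, k t²/2 > z) − e^{−max(x,y,z)}| ≤ (5M² + 3M + 2)/k`**
  (`abs_joint_tail_prob_sub_exp_le`)

— the joint convergence of the three rescaled coordinates of the explicit model to the diagonal `Exp(1)` law
is of order `1/k`, with a constant uniform in `λ ∈ [0, 2]`. Nothing is claimed about (N).

Blind lane: Mathlib + the HodgeRepro2 prefix only; no sorry; axioms ⊆ {propext, Classical.choice,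
Quot.sound}.
-/

namespace Summit.Ventures.HodgeRepro2.T5SU11JacobiJointLawRate

open MeasureTheory MeasureTheory.Measure Metric Set Filter Topology
open T5SU11Unimodular T5SU11Fibration T5SU11Cartan T5SU11OneParameter T5SU11CartanProjection T5HaarCircle
  T5BergmanCoefficient T5SU11FibrationHaar T5SU11SphericalFunction T5SU11SphericalSymmetry
  T5SU11SphericalBounds T5SU11SphericalContinuous T5SU11JacobiIwasawa T5SU11JacobiTransform
  T5SU11JacobiWeight T5SU11KFiniteMajorantPow T5SU11JacobiLaplacePhase T5SU11JacobiPhaseTailGroup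
  T5SU11PhaseTail T5SU11PhaseTailCartan T5SU11OrbitRadiusLaw T5SU11JacobiCartanLawAsymptotic
  T5SU11JacobiJointLawAsymptotic T5SU11JacobiPhaseLawRate T5SU11JacobiPhaseLawRateScaled
open scoped Real

/-! ### Elementary inequalities -/

/-- `|e^{−A} − e^{−B}| ≤ |A − B|` for `A, B ≥ 0`. -/
theorem abs_exp_neg_sub_exp_neg_le {A B : ℝ} (hA : 0 ≤ A) (hB : 0 ≤ B) :
    |Real.exp (-A) - Real.exp (-B)| ≤ |A - B| := by
  wlog h : A ≤ B generalizing A B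
  · have := this hB hA (le_of_lt (not_le.mp h))
    rwa [abs_sub_comm, abs_sub_comm B A] at this
  have hle : Real.exp (-B) ≤ Real.exp (-A) := Real.exp_le_exp.mpr (by linarith)
  rw [abs_of_nonneg (sub_nonneg.mpr hle), abs_of_nonpos (sub_nonpos.mpr h)]
  -- `e^{−A} − e^{−B} = e^{−A}(1 − e^{−(B − A)}) ≤ 1 · (B − A)`
  have h1 : Real.exp (-A) ≤ 1 := Real.exp_le_one_iff.mpr (by linarith)
  have h2 : 1 - Real.exp (-(B - A)) ≤ B - A := by
    have := Real.add_one_le_exp (-(B - A))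
    linarith
  have h3 : Real.exp (-B) = Real.exp (-A) * Real.exp (-(B - A)) := by
    rw [← Real.exp_add]
    congr 1
    ring
  rw [h3]
  have h4 : 0 ≤ 1 - Real.exp (-(B - A)) := by
    have := Real.exp_le_one_iff.mpr (by linarith : -(B - A) ≤ 0)
    linarith
  calc Real.exp (-A) - Real.exp (-A) * Real.exp (-(B - A))
      = Real.exp (-A) * (1 - Real.exp (-(B - A))) := by ring
    _ ≤ 1 * (B - A) := mul_le_mul h1 h2 h4 zero_le_one
    _ = -(A - B) := by ring

/-- `u ≤ −log(1 − u)` for `u < 1`. -/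
theorem le_neg_log_one_sub {u : ℝ} (hu : u < 1) : u ≤ -Real.log (1 - u) := by
  have := Real.log_le_sub_one_of_pos (by linarith : 0 < 1 - u)
  linarith

/-- `−log(1 − u) ≤ u/(1 − u)` for `u < 1`. -/
theorem neg_log_one_sub_le {u : ℝ} (hu : u < 1) : -Real.log (1 - u) ≤ u / (1 - u) := by
  have h := Real.one_sub_inv_le_log_of_pos (by linarith : 0 < 1 - u)
  have h1 : (1 - u)⁻¹ = 1 / (1 - u) := by rw [one_div]
  have h2 : 1 - 1 / (1 - u) = -(u / (1 - u)) := by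
    have : (1 - u) ≠ 0 := by linarith
    field_simp
    ring
  rw [h1, h2] at h
  linarith

/-! ### The rescaled threshold pinned -/

/-- **The rescaled threshold from below**: for `k > 2`, `k > 2y`, `x ≥ 0`, `y > 0`, `z ≥ 0`, with
`M = max(x, y, z)`, `M − (2M + M²)/k ≤ (k − 2)·jointThreshold(x, y, z, k)`. -/
theorem le_scaled_jointThreshold {x y z k : ℝ} (hk : 2 < k) (hky : 2 * y < k) (hx : 0 ≤ x) (hy : 0 < y)
    (hz : 0 ≤ z) :
    max x (max y z) - (2 * max x (max y z) + max x (max y z) ^ 2) / k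
      ≤ (k - 2) * jointThreshold x y z k := by
  have hk0 : 0 < k := by linarith
  have hr : 0 ≤ k - 2 := by linarith
  set M : ℝ := max x (max y z) with hM
  have hxM : x ≤ M := le_max_left _ _
  have hyM : y ≤ M := le_trans (le_max_left _ _) (le_max_right _ _)
  have hzM : z ≤ M := le_trans (le_max_right _ _) (le_max_right _ _)
  have hM0 : 0 ≤ M := hx.trans hxM
  -- the three thresholds from below
  have h1 : x - 2 * x / k ≤ (k - 2) * (x / k) := by
    have e : (k - 2) * (x / k) = x - 2 * x / k := by field_simp
    rw [e]
  have h2 : y - 2 * y / k ≤ (k - 2) * (-(1 / 2) * Real.log (1 - 2 * y / k)) := by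
    have hu : 2 * y / k < 1 := by rw [div_lt_one hk0]; exact hky
    have := le_neg_log_one_sub hu
    calc y - 2 * y / k = (k - 2) * (1 / 2 * (2 * y / k)) := by field_simp
      _ ≤ (k - 2) * (1 / 2 * (-Real.log (1 - 2 * y / k))) := by
          apply mul_le_mul_of_nonneg_left _ hr
          linarith
      _ = (k - 2) * (-(1 / 2) * Real.log (1 - 2 * y / k)) := by ring
  have h3 : z - z * (z + 2) / k ≤ (k - 2) * Real.log (Real.cosh (Real.sqrt (2 * z / k))) := by
    have hsq : Real.sqrt (2 * z / k) ^ 2 = 2 * z / k := Real.sq_sqrt (by positivity)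
    have hl := le_log_cosh (Real.sqrt_nonneg (2 * z / k))
    rw [hsq] at hl
    have e : (2 * z / k / 2) / (1 + 2 * z / k / 2) = z / (k + z) := by
      have : k + z ≠ 0 := by linarith
      field_simp
    rw [e] at hl
    calc z - z * (z + 2) / k ≤ (k - 2) * (z / (k + z)) := by
          have hkz : 0 < k + z := by linarith
          have e : (k - 2) * (z / (k + z)) = z - z * (z + 2) / (k + z) := by
            field_simp
            ring
          rw [e]
          have : z * (z + 2) / (k + z) ≤ z * (z + 2) / k :=
            div_le_div_of_nonneg_left (by positivity) hk0 (by linarith)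
          linarith
      _ ≤ (k - 2) * Real.log (Real.cosh (Real.sqrt (2 * z / k))) :=
          mul_le_mul_of_nonneg_left hl hr
  -- the deficits are at most `(2M + M²)/k`
  have hd : ∀ w, 0 ≤ w → w ≤ M → 2 * w / k ≤ (2 * M + M ^ 2) / k := fun w hw hwM => by
    apply div_le_div_of_nonneg_right _ hk0.le
    nlinarith
  have hd3 : z * (z + 2) / k ≤ (2 * M + M ^ 2) / k := by
    apply div_le_div_of_nonneg_right _ hk0.le
    nlinarith
  have hjT : ∀ w ∈ ({x / k, -(1 / 2) * Real.log (1 - 2 * y / k),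
      Real.log (Real.cosh (Real.sqrt (2 * z / k)))} : Set ℝ), w ≤ jointThreshold x y z k := by
    intro w hw
    simp only [mem_insert_iff, mem_singleton_iff] at hw
    rcases hw with rfl | rfl | rfl
    · exact le_max_left _ _
    · exact le_trans (le_max_left _ _) (le_max_right _ _)
    · exact le_trans (le_max_right _ _) (le_max_right _ _)
  have hA := mul_le_mul_of_nonneg_left (hjT (x / k) (by simp)) hr
  have hB := mul_le_mul_of_nonneg_left (hjT (-(1 / 2) * Real.log (1 - 2 * y / k)) (by simp)) hr
  have hC := mul_le_mul_of_nonneg_left (hjT (Real.log (Real.cosh (Real.sqrt (2 * z / k)))) (by simp)) hr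
  rw [_root_.sub_le_iff_le_add]
  refine max_le ?_ (max_le ?_ ?_)
  · linarith [hd x hx hxM]
  · linarith [hd y hy.le hyM]
  · linarith

/-- **The rescaled threshold from above**: for `k ≥ 4y`, `k > 2`, `x ≥ 0`, `y > 0`, `z ≥ 0`, with
`M = max(x, y, z)`, `(k − 2)·jointThreshold(x, y, z, k) ≤ M + 4M²/k`. -/
theorem scaled_jointThreshold_le {x y z k : ℝ} (hk : 2 < k) (hky : 4 * y ≤ k) (hx : 0 ≤ x) (hy : 0 < y)
    (hz : 0 ≤ z) :
    (k - 2) * jointThreshold x y z k ≤ max x (max y z) + 4 * max x (max y z) ^ 2 / k := by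
  have hk0 : 0 < k := by linarith
  have hr : 0 ≤ k - 2 := by linarith
  set M : ℝ := max x (max y z) with hM
  have hxM : x ≤ M := le_max_left _ _
  have hyM : y ≤ M := le_trans (le_max_left _ _) (le_max_right _ _)
  have hzM : z ≤ M := le_trans (le_max_right _ _) (le_max_right _ _)
  have hM0 : 0 ≤ M := hx.trans hxM
  have hM2 : 0 ≤ 4 * M ^ 2 / k := by positivity
  -- the three thresholds from above
  have h1 : (k - 2) * (x / k) ≤ x := by
    rw [show (k - 2) * (x / k) = x - 2 * x / k by field_simp]
    have : 0 ≤ 2 * x / k := by positivity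
    linarith
  have h2 : (k - 2) * (-(1 / 2) * Real.log (1 - 2 * y / k)) ≤ y + 4 * y ^ 2 / k := by
    have hu : 2 * y / k < 1 := by
      rw [div_lt_one hk0]
      linarith
    have hl := neg_log_one_sub_le hu
    have hk2y : 0 < k - 2 * y := by linarith
    have e : 2 * y / k / (1 - 2 * y / k) = 2 * y / (k - 2 * y) := by
      field_simp
    rw [e] at hl
    calc (k - 2) * (-(1 / 2) * Real.log (1 - 2 * y / k))
        = (k - 2) * (1 / 2) * (-Real.log (1 - 2 * y / k)) := by ring
      _ ≤ (k - 2) * (1 / 2) * (2 * y / (k - 2 * y)) :=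
          mul_le_mul_of_nonneg_left hl (by positivity)
      _ = y * (k - 2) / (k - 2 * y) := by field_simp
      _ ≤ y + 4 * y ^ 2 / k := by
          rw [div_le_iff₀ hk2y]
          have hk2y' : k / 2 ≤ k - 2 * y := by linarith
          have : 4 * y ^ 2 / k * (k - 2 * y) ≥ 4 * y ^ 2 / k * (k / 2) :=
            mul_le_mul_of_nonneg_left hk2y' (by positivity)
          have e2 : 4 * y ^ 2 / k * (k / 2) = 2 * y ^ 2 := by field_simp; ring
          nlinarith
  have h3 : (k - 2) * Real.log (Real.cosh (Real.sqrt (2 * z / k))) ≤ z := by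
    have hsq : Real.sqrt (2 * z / k) ^ 2 = 2 * z / k := Real.sq_sqrt (by positivity)
    have hl := log_cosh_le (Real.sqrt (2 * z / k))
    rw [hsq] at hl
    calc (k - 2) * Real.log (Real.cosh (Real.sqrt (2 * z / k))) ≤ (k - 2) * (2 * z / k / 2) :=
          mul_le_mul_of_nonneg_left hl hr
      _ = z - 2 * z / k := by field_simp
      _ ≤ z := by
          have : 0 ≤ 2 * z / k := by positivity
          linarith
  have hy2 : 4 * y ^ 2 / k ≤ 4 * M ^ 2 / k := by
    apply div_le_div_of_nonneg_right _ hk0.le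
    nlinarith
  simp only [jointThreshold]
  rw [mul_max_of_nonneg _ _ hr, mul_max_of_nonneg _ _ hr]
  refine max_le ?_ (max_le ?_ ?_)
  · linarith
  · linarith
  · linarith

section measure

variable [MeasurableSpace Circle] [BorelSpace Circle]

/-! ### The rate -/

/-- **THE RATE OF THE JOINT LIMIT LAW, UNIFORMLY IN `0 ≤ λ ≤ 2`**: for `k ≥ 4`, `k ≥ 4y`, `x ≥ 0`, `y > 0`,
`z ≥ 0` and `M = max(x, y, z)`,
`|P_{k,λ}(k log|a| > x, k|g·0|²/2 > y, k t²/2 > z) − e^{−M}| ≤ (5M² + 3M + 2)/k`. -/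
theorem abs_joint_tail_prob_sub_exp_le {k lam x y z : ℝ} (hk : 4 ≤ k) (hky : 4 * y ≤ k) (h0 : 0 ≤ lam)
    (h2 : lam ≤ 2) (hx : 0 ≤ x) (hy : 0 < y) (hz : 0 ≤ z) :
    |(∫ g in {g : SU11 | x / k < Real.log ‖mat g 0 0‖ ∧ 2 * y / k < ‖orbit g‖ ^ 2 ∧
          Real.sqrt (2 * z / k) < cartanT g},
        (1 - ‖orbit g‖ ^ 2) ^ (k / 2) * sph lam g ∂(nu haarCircle))
      / (∫ g, (1 - ‖orbit g‖ ^ 2) ^ (k / 2) * sph lam g ∂(nu haarCircle))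
      - Real.exp (-max x (max y z))|
      ≤ (5 * max x (max y z) ^ 2 + 3 * max x (max y z) + 2) / k := by
  have hk2 : 2 < k := by linarith
  have hk0 : 0 < k := by linarith
  have hr : 0 < k - 2 := by linarith
  have hky2 : 2 * y < k := by linarith
  set M : ℝ := max x (max y z) with hM
  have hM0 : 0 ≤ M := hx.trans (le_max_left _ _)
  set τ : ℝ := jointThreshold x y z k with hτ
  have hτ0 : 0 ≤ τ := jointThreshold_nonneg hx hk0
  rw [setOf_joint_gt_eq hy hky2]
  -- the two estimates
  have hrate := abs_phase_tail_prob_sub_exp_le' (k := k) (lam := lam) (t := τ) (by linarith) h0 h2 hτ0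
  have hlo := le_scaled_jointThreshold hk2 hky2 hx hy hz
  have hup := scaled_jointThreshold_le hk2 hky hx hy hz
  rw [← hM, ← hτ] at hlo hup
  have hexp : |Real.exp (-((k - 2) * τ)) - Real.exp (-M)| ≤ |(k - 2) * τ - M| :=
    abs_exp_neg_sub_exp_neg_le (by positivity) hM0
  -- the threshold deficit
  have hthr : |(k - 2) * τ - M| ≤ (4 * M ^ 2 + 2 * M) / k := by
    rw [abs_le]
    constructor
    · have : (2 * M + M ^ 2) / k ≤ (4 * M ^ 2 + 2 * M) / k := by
        apply div_le_div_of_nonneg_right _ hk0.le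
        nlinarith
      linarith
    · have : 4 * M ^ 2 / k ≤ (4 * M ^ 2 + 2 * M) / k := by
        apply div_le_div_of_nonneg_right _ hk0.le
        nlinarith
      linarith
  -- the first term: `c (τ + 2/(k−2)) e^{−(k−2)τ} ≤ (M² + M + 2)/k`
  have hc : lam * (2 - lam) / 2 ≤ 1 / 2 := by nlinarith [sq_nonneg (lam - 1)]
  have hc0 : 0 ≤ lam * (2 - lam) / 2 := by nlinarith
  have hτle : τ ≤ (M + 4 * M ^ 2 / k) / (k - 2) := by
    rw [le_div_iff₀ hr]
    linarith
  have hinv : 1 / (k - 2) ≤ 2 / k := by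
    rw [div_le_div_iff₀ hr hk0]
    linarith
  have hfirst : lam * (2 - lam) / 2 * (τ + 2 / (k - 2)) * Real.exp (-((k - 2) * τ))
      ≤ (M ^ 2 + M + 2) / k := by
    have he : Real.exp (-((k - 2) * τ)) ≤ 1 := Real.exp_le_one_iff.mpr (by nlinarith)
    have hτ2 : τ + 2 / (k - 2) ≤ (M + 4 * M ^ 2 / k + 2) * (2 / k) := by
      have : (M + 4 * M ^ 2 / k) / (k - 2) ≤ (M + 4 * M ^ 2 / k) * (2 / k) := by
        rw [div_eq_mul_one_div]
        exact mul_le_mul_of_nonneg_left hinv (by positivity)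
      have : 2 / (k - 2) ≤ 2 * (2 / k) := by
        rw [show (2 : ℝ) / (k - 2) = 2 * (1 / (k - 2)) by ring]
        exact mul_le_mul_of_nonneg_left hinv (by norm_num)
      nlinarith
    have h4M : 4 * M ^ 2 / k ≤ M ^ 2 := by
      rw [div_le_iff₀ hk0]
      nlinarith
    calc lam * (2 - lam) / 2 * (τ + 2 / (k - 2)) * Real.exp (-((k - 2) * τ))
        ≤ 1 / 2 * ((M + 4 * M ^ 2 / k + 2) * (2 / k)) * 1 := by
          apply mul_le_mul _ he (Real.exp_pos _).le (by positivity)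
          exact mul_le_mul hc hτ2 (by positivity) (by norm_num)
      _ = (M + 4 * M ^ 2 / k + 2) / k := by ring
      _ ≤ (M ^ 2 + M + 2) / k := by
          apply div_le_div_of_nonneg_right _ hk0.le
          linarith
  -- assemble
  have hsum : (M ^ 2 + M + 2) / k + (4 * M ^ 2 + 2 * M) / k = (5 * M ^ 2 + 3 * M + 2) / k := by
    rw [← add_div]
    ring_nf
  calc |(∫ g in {g : SU11 | τ < Real.log ‖mat g 0 0‖},
          (1 - ‖orbit g‖ ^ 2) ^ (k / 2) * sph lam g ∂(nu haarCircle))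
        / (∫ g, (1 - ‖orbit g‖ ^ 2) ^ (k / 2) * sph lam g ∂(nu haarCircle)) - Real.exp (-M)|
      = |((∫ g in {g : SU11 | τ < Real.log ‖mat g 0 0‖},
            (1 - ‖orbit g‖ ^ 2) ^ (k / 2) * sph lam g ∂(nu haarCircle))
          / (∫ g, (1 - ‖orbit g‖ ^ 2) ^ (k / 2) * sph lam g ∂(nu haarCircle))
            - Real.exp (-((k - 2) * τ))) + (Real.exp (-((k - 2) * τ)) - Real.exp (-M))| := by
        congr 1
        ring
    _ ≤ |(∫ g in {g : SU11 | τ < Real.log ‖mat g 0 0‖},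
            (1 - ‖orbit g‖ ^ 2) ^ (k / 2) * sph lam g ∂(nu haarCircle))
          / (∫ g, (1 - ‖orbit g‖ ^ 2) ^ (k / 2) * sph lam g ∂(nu haarCircle))
            - Real.exp (-((k - 2) * τ))| + |Real.exp (-((k - 2) * τ)) - Real.exp (-M)| :=
        abs_add_le _ _
    _ ≤ (M ^ 2 + M + 2) / k + (4 * M ^ 2 + 2 * M) / k := by
        gcongr
        · exact hrate.trans hfirst
        · exact hexp.trans hthr
    _ = (5 * M ^ 2 + 3 * M + 2) / k := hsum

end measure

end Summit.Ventures.HodgeRepro2.T5SU11JacobiJointLawRate
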